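import Mathlib
import Summits.Ventures.DiscreteObjects.Mahler.LehmerLowerBound

/-!
# The dominant-root dichotomy (venture `DiscreteObjects`, target L, family L6, METHOD-L6c)

Cell `pub-namedobj`, seat `pub-namedobj-mahler` (gen 5). Framing: lottery ticket; floor = certified
bounds/negative ranges.

Kernel record of the elementary lemma behind the decomposed census of family L6 (cell file
`METHOD-L6c.md`, Lemma 2): for a monic integer polynomial `P` with Mahler measure `M(P) < B`, a complex
root `z` with `|z|² > B` is REAL (otherwise `z̄ ≠ z` is another root and `M(P) ≥ |z|·|z̄| = |z|² > B`) and
every OTHER root `w` (counted with multiplicity, i.e. `w ∈ roots.erase z`) satisfies `|z|·|w| ≤ M(P)`, hence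
`|w|² < B`.  So either all roots have `|α|² ≤ B` ("case A") or there is exactly one root of larger modulus,
and it is real ("case B") — the two kinds of certified boxes of the decomposed census.

* `norm_mul_norm_le_intMahlerMeasure` — two roots (with multiplicity) `z`, `w`: `‖z‖·‖w‖ ≤ M(P)`;
* `conj_eq_of_sq_gt` — a root with `‖z‖² > B > M(P)` is fixed by complex conjugation;
* `norm_sq_lt_of_sq_gt` — every other root then has `‖w‖² < B`.
-/

namespace Summit.Ventures.DiscreteObjects.Mahler

open Polynomial

/-- In a multiset of reals `≥ 1`, the product of two members (with multiplicity) is at most the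
product of the multiset. -/
theorem mul_le_prod_of_mem_of_mem_erase {s : Multiset ℝ} (h : ∀ y ∈ s, 1 ≤ y) {x y : ℝ}
    (hx : x ∈ s) (hy : y ∈ s.erase x) : x * y ≤ s.prod := by
  classical
  obtain ⟨t, rfl⟩ := Multiset.exists_cons_of_mem hx
  rw [Multiset.erase_cons_head] at hy
  obtain ⟨u, rfl⟩ := Multiset.exists_cons_of_mem hy
  rw [Multiset.prod_cons, Multiset.prod_cons]
  have hx1 : 1 ≤ x := h x (Multiset.mem_cons_self _ _)
  have hy1 : 1 ≤ y := h y (Multiset.mem_cons_of_mem (Multiset.mem_cons_self _ _))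
  have hu : 1 ≤ u.prod := one_le_multiset_prod
    (fun w hw => h w (Multiset.mem_cons_of_mem (Multiset.mem_cons_of_mem hw)))
  have hxy : 0 ≤ x * y := by positivity
  nlinarith


/-- Membership in the complex root multiset `(p.map ℂ).roots` is being a complex root of `p` (for `p ≠ 0`). -/
theorem mem_cRoots_iff {p : ℤ[X]} (hp : p ≠ 0) {z : ℂ} : z ∈ (p.map (Int.castRingHom ℂ)).roots ↔ aeval z p = 0 := by
  have h0 : p.map (Int.castRingHom ℂ) ≠ 0 :=
    (Polynomial.map_ne_zero_iff (RingHom.injective_int (Int.castRingHom ℂ))).mpr hp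
  rw [mem_roots h0, IsRoot.def, eval_map, aeval_def, algebraMap_int_eq]

/-- **Two roots.** For a monic integer polynomial and two of its complex roots `z`, `w` counted with
multiplicity (`w ∈ ((p.map (Int.castRingHom ℂ)).roots).erase z`), `‖z‖·‖w‖ ≤ M(p)`. -/
theorem norm_mul_norm_le_intMahlerMeasure {p : ℤ[X]} (hp : p.Monic) {z w : ℂ}
    (hz : z ∈ (p.map (Int.castRingHom ℂ)).roots) (hw : w ∈ ((p.map (Int.castRingHom ℂ)).roots).erase z) : ‖z‖ * ‖w‖ ≤ intMahlerMeasure p := by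
  classical
  unfold intMahlerMeasure
  set q : ℂ[X] := p.map (Int.castRingHom ℂ) with hq
  have hqm : q.Monic := hp.map _
  rw [mahlerMeasure_eq_leadingCoeff_mul_prod_roots, hqm.leadingCoeff, norm_one, one_mul]
  set s : Multiset ℝ := q.roots.map (fun a => max 1 ‖a‖) with hs
  have hall : ∀ y ∈ s, 1 ≤ y := by
    intro y hy
    obtain ⟨a, _, rfl⟩ := Multiset.mem_map.mp hy
    exact le_max_left _ _
  have hzs : max 1 ‖z‖ ∈ s := Multiset.mem_map_of_mem _ hz
  have hws : max 1 ‖w‖ ∈ s.erase (max 1 ‖z‖) := by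
    have h1 : (q.roots.erase z).map (fun a => max 1 ‖a‖) = s.erase (max 1 ‖z‖) := by
      rw [hs]
      exact Multiset.map_erase_of_mem _ _ hz
    rw [← h1]
    exact Multiset.mem_map_of_mem _ hw
  have hle := mul_le_prod_of_mem_of_mem_erase hall hzs hws
  have h1 : ‖z‖ ≤ max 1 ‖z‖ := le_max_right _ _
  have h2 : ‖w‖ ≤ max 1 ‖w‖ := le_max_right _ _
  calc ‖z‖ * ‖w‖ ≤ max 1 ‖z‖ * max 1 ‖w‖ := mul_le_mul h1 h2 (norm_nonneg _) (le_trans zero_le_one (le_max_left _ _))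
    _ ≤ s.prod := hle

/-- Complex conjugation permutes the roots (with multiplicity) of an integer polynomial: if `z` is a
root then so is `conj z`. -/
theorem conj_mem_cRoots {p : ℤ[X]} (hp : p ≠ 0) {z : ℂ} (hz : z ∈ (p.map (Int.castRingHom ℂ)).roots) :
    (starRingEnd ℂ) z ∈ (p.map (Int.castRingHom ℂ)).roots := by
  rw [mem_cRoots_iff hp] at hz ⊢
  have h := Polynomial.aeval_algHom_apply ((starRingEnd ℂ).toIntAlgHom) z p
  rw [RingHom.toIntAlgHom_apply] at h
  -- `h : aeval ((starRingEnd ℂ) z) p = (starRingEnd ℂ) (aeval z p)`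
  rw [h, hz, map_zero]

/-- **Dichotomy, part 1 (the dominant root is real).** If `M(p) < B` and a root `z` has `‖z‖² > B`,
then `z` is fixed by complex conjugation. -/
theorem conj_eq_of_sq_gt {p : ℤ[X]} (hp : p.Monic) {B : ℝ} (hM : intMahlerMeasure p < B) {z : ℂ}
    (hz : z ∈ (p.map (Int.castRingHom ℂ)).roots) (hzB : B < ‖z‖ ^ 2) : (starRingEnd ℂ) z = z := by
  classical
  by_contra hne
  have hzc : (starRingEnd ℂ) z ∈ ((p.map (Int.castRingHom ℂ)).roots).erase z :=
    (Multiset.mem_erase_of_ne hne).mpr (conj_mem_cRoots hp.ne_zero hz)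
  have hle := norm_mul_norm_le_intMahlerMeasure hp hz hzc
  rw [Complex.norm_conj] at hle
  nlinarith

/-- **Dichotomy, part 2 (uniqueness / case B shape).** If `M(p) < B` and a root `z` has `‖z‖² > B`,
then every other root `w` (with multiplicity: `w ∈ ((p.map (Int.castRingHom ℂ)).roots).erase z`) has `‖z‖·‖w‖ ≤ M(p)` and in
particular `‖w‖² < B`. -/
theorem norm_sq_lt_of_sq_gt {p : ℤ[X]} (hp : p.Monic) {B : ℝ} (hM : intMahlerMeasure p < B) {z w : ℂ}
    (hz : z ∈ (p.map (Int.castRingHom ℂ)).roots) (hw : w ∈ ((p.map (Int.castRingHom ℂ)).roots).erase z) (hzB : B < ‖z‖ ^ 2) : ‖w‖ ^ 2 < B := by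
  have hle := norm_mul_norm_le_intMahlerMeasure hp hz hw
  have hz0 : 0 ≤ ‖z‖ := norm_nonneg _
  have hw0 : 0 ≤ ‖w‖ := norm_nonneg _
  have hM0 : 0 ≤ intMahlerMeasure p := Polynomial.mahlerMeasure_nonneg _
  have hB : 0 < B := lt_of_le_of_lt hM0 hM
  have h1 : ‖z‖ * ‖w‖ < B := lt_of_le_of_lt hle hM
  by_contra hge
  rw [not_lt] at hge
  have hw2 : 0 < ‖w‖ ^ 2 := lt_of_lt_of_le hB hge
  have h2 : B * B < ‖z‖ ^ 2 * ‖w‖ ^ 2 :=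
    calc B * B ≤ B * ‖w‖ ^ 2 := mul_le_mul_of_nonneg_left hge hB.le
      _ < ‖z‖ ^ 2 * ‖w‖ ^ 2 := mul_lt_mul_of_pos_right hzB hw2
  have h3 : (‖z‖ * ‖w‖) ^ 2 < B ^ 2 := pow_lt_pow_left₀ h1 (mul_nonneg hz0 hw0) two_ne_zero
  have h4 : (‖z‖ * ‖w‖) ^ 2 = ‖z‖ ^ 2 * ‖w‖ ^ 2 := by ring
  have h5 : B ^ 2 = B * B := by ring
  linarith

/-- **Dichotomy (METHOD-L6c Lemma 2), packaged.** For a monic integer polynomial with `M(p) < B`: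
either every complex root has `‖α‖² ≤ B` (case A), or some root `z` has `‖z‖² > B`, and then `z` is
real and all other roots (with multiplicity) have `‖w‖² < B` (case B). -/
theorem dominant_root_dichotomy {p : ℤ[X]} (hp : p.Monic) {B : ℝ} (hM : intMahlerMeasure p < B) :
    (∀ z ∈ (p.map (Int.castRingHom ℂ)).roots, ‖z‖ ^ 2 ≤ B) ∨
    (∃ z ∈ (p.map (Int.castRingHom ℂ)).roots, B < ‖z‖ ^ 2 ∧ (starRingEnd ℂ) z = z ∧ ∀ w ∈ ((p.map (Int.castRingHom ℂ)).roots).erase z, ‖w‖ ^ 2 < B) := by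
  by_cases h : ∀ z ∈ (p.map (Int.castRingHom ℂ)).roots, ‖z‖ ^ 2 ≤ B
  · exact Or.inl h
  · push Not at h
    obtain ⟨z, hz, hzB⟩ := h
    exact Or.inr ⟨z, hz, hzB, conj_eq_of_sq_gt hp hM hz hzB,
      fun w hw => norm_sq_lt_of_sq_gt hp hM hz hw hzB⟩

end Summit.Ventures.DiscreteObjects.Mahler
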